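import Summits.RiemannHypothesis.RiemannHypothesis.Theorems.WeilCombCombShapePositivityDivisorGapTwoBlock

/-!
# Parity (two-block) step of the induction for the divisor-graph Dirichlet gap — towards stub `stub_divisorGapPerp`
(line `Sketch` of crux `WeilComb.CombShapePositivity`, item stmt-RiemannHypothesis-11229, plan id B6)

The stub asks for the spectral gap `D_M(y) ≥ ‖y‖²` of the Dirichlet energy of the divisor graph
`D_M(y) = Σ_{m ≤ M} Σ_{n ≤ M/m} Λ(n) ‖y(nm) − n^{-1/2} y(m)‖²` on the orthogonal complement of its
Perron ground state `u_k = k^{-1/2}` (`M ≥ 12`).  Equivalently (variance form, no constraint)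
`V(M) : Σ_{m ≤ M} ‖y_m‖² − |Σ_{m ≤ M} y_m m^{-1/2}|² / H_M ≤ D_M(y)` for every `y`, `H_M = Σ_{m ≤ M} 1/m`.

* `divisorGap_parityStep` : for `M ≥ 6`, `V(⌊M/2⌋)` applied to `j ↦ y(2j)` (the even block
  `2·[1, M/2]` with all its edges is an exact copy of the graph at `⌊M/2⌋`) together with the odd-block
  inequality `R(M)` — a Poincaré inequality for the graph on the odd numbers `≤ M` with odd prime-power
  edges, strengthened by ONE explicit rank-one term (the exact Schur complement of the even block):
  `Σ_{r odd} ‖y_r‖² − |aO|²/πO + K |T/πE − aO/πO|² ≤ Σ_{r odd} Σ_{n ≤ M/r odd} Λ(n) ‖y(nr) − n^{-1/2} y(r)‖²`,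
  `πO = Σ_{r≤M odd} 1/r`, `πE = Σ_{k≤M even} 1/k`, `aO = Σ_{r odd} y_r r^{-1/2}`,
  `T = Σ_{r odd} y_r r^{-1/2}(1 − 2^{-⌊log₂(M/r)⌋})`, `K = log 2·πO·πE/(log 2·H_M − πO)` — imply `V(M)`
  (`twoBlock_complex` + Cauchy–Schwarz on all cross edges `r — 2^a r`);
* `divisorGap_of_variance` : `V(M)` implies the registered (constrained) form;
* `divisorGap_of_base_of_oddBlock` : the strong induction assembled — base cases `V(M)`, `12 ≤ M < 2N`,
  and `R(M)` for `M ≥ 2N` give the stub for all `M ≥ 12`.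

Numerics (pure python, exact second eigenvalues, lead c3 worker B6): `R(M)` holds with margin
`≥ 0.2619 · Σ_{r odd} ‖y_r‖²` (on the complement of its kernel `y ∝ u`) for every `12 ≤ M ≤ 129` and
for sampled `M ≤ 256` (minimum at `M = 13`; `0.48` at `M = 129`, `0.50` at `M = 256`, increasing like the
odd graph's own gap `1.28 … 1.51`), so the
rank-one term is nearly free; `λ₂(D_M) ≥ 1.052` for all `M ≥ 12` but `λ₂(D_7) = 0.986`, `λ₂(D_9) = 0.997`,
which is why the induction needs base cases on `[12, 24)` rather than `[6, 12)`.  NOT proved here: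
`R(M)` for all large `M` (a spectral gap of the odd divisor graph uniform in `M`) and the base cases.
-/

noncomputable section

-- the sub-problem path RiemannHypothesis/RiemannHypothesis duplicates a namespace (D-0017)
set_option linter.dupNamespace false

open scoped BigOperators
open Finset

namespace Summit.RiemannHypothesis.RiemannHypothesis.Theorems.WeilCombBohrFejer

/-- From the variance form `V(M)` of the gap to the registered (constrained) form of the stub. -/
theorem divisorGap_of_variance (M : ℕ) (y : ℕ → ℂ)
    (hV : ∑ m ∈ Icc 1 M, ‖y m‖ ^ 2 -
        ‖∑ m ∈ Icc 1 M, y m * ((Real.sqrt (m : ℝ) : ℝ) : ℂ)⁻¹‖ ^ 2 / (∑ m ∈ Icc 1 M, (1 : ℝ) / m) ≤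
      ∑ m ∈ Icc 1 M, ∑ n ∈ Icc 1 (M / m), (ArithmeticFunction.vonMangoldt n : ℝ) *
        ‖y (n * m) - ((Real.sqrt n : ℂ))⁻¹ * y m‖ ^ 2)
    (hy : ∑ m ∈ Icc 1 M, y m * ((Real.sqrt (m : ℝ) : ℝ) : ℂ)⁻¹ = 0) :
    ∑ m ∈ Icc 1 M, ‖y m‖ ^ 2 ≤
      ∑ m ∈ Icc 1 M, ∑ n ∈ Icc 1 (M / m), (ArithmeticFunction.vonMangoldt n : ℝ) *
        ‖y (n * m) - ((Real.sqrt n : ℂ))⁻¹ * y m‖ ^ 2 := by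
  rw [hy, norm_zero] at hV
  simpa using hV

/-- **Parity step of the induction.**  Let `M ≥ 6`.  Assume
* `hE` : the variance inequality `V(⌊M/2⌋)` for the dilated sequence `j ↦ y(2j)` (the even block
  `{2j : j ≤ M/2}` of `[1, M]` with all its edges is an exact copy of the divisor graph at `⌊M/2⌋`);
* `hR` : the odd-block inequality `R(M)`: writing `πO = Σ_{r ≤ M odd} 1/r`, `πE = Σ_{k ≤ M even} 1/k`,
  `H_M = Σ_{m ≤ M} 1/m`, `aO = Σ_{r odd} y_r r^{-1/2}`,
  `T = Σ_{r odd} y_r r^{-1/2} (1 − 2^{-⌊log₂(M/r)⌋})` and `K = log 2 · πO · πE / (log 2 · H_M − πO)`,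
  `Σ_{r odd} ‖y_r‖² − |aO|²/πO + K |T/πE − aO/πO|² ≤ Σ_{r odd} Σ_{n ≤ M/r odd} Λ(n) ‖y(nr) − n^{-1/2} y(r)‖²`.
Then `V(M)` holds for `y`:
`Σ_{m ≤ M} ‖y_m‖² − |Σ_{m ≤ M} y_m m^{-1/2}|²/H_M ≤ Σ_{m ≤ M} Σ_{n ≤ M/m} Λ(n) ‖y(nm) − n^{-1/2} y(m)‖²`. -/
theorem divisorGap_parityStep (M : ℕ) (hM : 6 ≤ M) (y : ℕ → ℂ)
    (hE : ∑ j ∈ Icc 1 (M / 2), ‖y (2 * j)‖ ^ 2 -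
        ‖∑ j ∈ Icc 1 (M / 2), y (2 * j) * ((Real.sqrt (j : ℝ) : ℝ) : ℂ)⁻¹‖ ^ 2 /
          (∑ j ∈ Icc 1 (M / 2), (1 : ℝ) / j) ≤
      ∑ m ∈ Icc 1 (M / 2), ∑ n ∈ Icc 1 (M / 2 / m), (ArithmeticFunction.vonMangoldt n : ℝ) *
        ‖y (2 * (n * m)) - ((Real.sqrt n : ℂ))⁻¹ * y (2 * m)‖ ^ 2)
    (hR : ∑ r ∈ (Icc 1 M).filter (fun r => Odd r), ‖y r‖ ^ 2 -
        ‖∑ r ∈ (Icc 1 M).filter (fun r => Odd r), y r * ((Real.sqrt (r : ℝ) : ℝ) : ℂ)⁻¹‖ ^ 2 /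
          (∑ r ∈ (Icc 1 M).filter (fun r => Odd r), (1 : ℝ) / r) +
        Real.log 2 * (∑ r ∈ (Icc 1 M).filter (fun r => Odd r), (1 : ℝ) / r) *
            (∑ k ∈ (Icc 1 M).filter (fun k => Even k), (1 : ℝ) / k) /
          (Real.log 2 * (∑ m ∈ Icc 1 M, (1 : ℝ) / m) -
            ∑ r ∈ (Icc 1 M).filter (fun r => Odd r), (1 : ℝ) / r) *
        ‖(∑ r ∈ (Icc 1 M).filter (fun r => Odd r),
              y r * ((Real.sqrt (r : ℝ) : ℝ) : ℂ)⁻¹ * (1 - ((2 : ℂ) ^ Nat.log 2 (M / r))⁻¹)) /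
            ((∑ k ∈ (Icc 1 M).filter (fun k => Even k), (1 : ℝ) / k : ℝ) : ℂ) -
          (∑ r ∈ (Icc 1 M).filter (fun r => Odd r), y r * ((Real.sqrt (r : ℝ) : ℝ) : ℂ)⁻¹) /
            ((∑ r ∈ (Icc 1 M).filter (fun r => Odd r), (1 : ℝ) / r : ℝ) : ℂ)‖ ^ 2 ≤
      ∑ r ∈ (Icc 1 M).filter (fun r => Odd r), ∑ n ∈ (Icc 1 (M / r)).filter (fun n => Odd n),
        (ArithmeticFunction.vonMangoldt n : ℝ) * ‖y (n * r) - ((Real.sqrt n : ℂ))⁻¹ * y r‖ ^ 2) :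
    ∑ m ∈ Icc 1 M, ‖y m‖ ^ 2 -
        ‖∑ m ∈ Icc 1 M, y m * ((Real.sqrt (m : ℝ) : ℝ) : ℂ)⁻¹‖ ^ 2 / (∑ m ∈ Icc 1 M, (1 : ℝ) / m) ≤
      ∑ m ∈ Icc 1 M, ∑ n ∈ Icc 1 (M / m), (ArithmeticFunction.vonMangoldt n : ℝ) *
        ‖y (n * m) - ((Real.sqrt n : ℂ))⁻¹ * y m‖ ^ 2 := by
  -- names
  set O := (Icc 1 M).filter (fun r => Odd r) with hO
  set Ev := (Icc 1 M).filter (fun k => Even k) with hEv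
  set u : ℕ → ℂ := fun m => ((Real.sqrt (m : ℝ) : ℝ) : ℂ)⁻¹ with hu
  set F : ℕ → ℕ → ℝ := fun m n =>
    (ArithmeticFunction.vonMangoldt n : ℝ) * ‖y (n * m) - ((Real.sqrt n : ℂ))⁻¹ * y m‖ ^ 2 with hF
  set PO := ∑ r ∈ O, (1 : ℝ) / r with hPO
  set PE := ∑ k ∈ Ev, (1 : ℝ) / k with hPE
  set aO := ∑ r ∈ O, y r * u r with haO
  set aE := ∑ k ∈ Ev, y k * u k with haE
  set T := ∑ r ∈ O, y r * u r * (1 - ((2 : ℂ) ^ Nat.log 2 (M / r))⁻¹) with hT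
  set SO := ∑ r ∈ O, ‖y r‖ ^ 2 with hSO
  set SE := ∑ k ∈ Ev, ‖y k‖ ^ 2 with hSE
  set DO := ∑ r ∈ O, ∑ n ∈ (Icc 1 (M / r)).filter (fun n => Odd n), F r n with hDO
  set DE := ∑ k ∈ Ev, ∑ n ∈ Icc 1 (M / k), F k n with hDE
  set CR := ∑ r ∈ O, ∑ n ∈ (Icc 1 (M / r)).filter (fun n => Even n), F r n with hCR
  set C2 := ∑ r ∈ O, ∑ a ∈ Icc 1 (Nat.log 2 (M / r)),
    ‖y (2 ^ a * r) - ((Real.sqrt ((2 ^ a : ℕ) : ℝ) : ℝ) : ℂ)⁻¹ * y r‖ ^ 2 with hC2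
  have hnotOdd : ∀ s : Finset ℕ, s.filter (fun k => ¬Odd k) = s.filter (fun k => Even k) :=
    fun s => filter_congr fun k _ => Nat.not_odd_iff_even
  -- splitting the three global sums over the parity of `m`
  have hH : ∑ m ∈ Icc 1 M, (1 : ℝ) / m = PO + PE := by
    rw [hPO, hPE, hO, hEv, ← hnotOdd, sum_filter_add_sum_filter_not]
  have hS : ∑ m ∈ Icc 1 M, ‖y m‖ ^ 2 = SO + SE := by
    rw [hSO, hSE, hO, hEv, ← hnotOdd, sum_filter_add_sum_filter_not]
  have hA : ∑ m ∈ Icc 1 M, y m * ((Real.sqrt (m : ℝ) : ℝ) : ℂ)⁻¹ = aO + aE := by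
    rw [haO, haE, hO, hEv, ← hnotOdd, sum_filter_add_sum_filter_not]
  have hD : ∑ m ∈ Icc 1 M, ∑ n ∈ Icc 1 (M / m), F m n = DO + CR + DE := by
    rw [hDO, hCR, hDE, ← sum_add_distrib, hO, hEv, ← hnotOdd]
    rw [← sum_filter_add_sum_filter_not (Icc 1 M) (fun r => Odd r)]
    congr 1
    refine sum_congr rfl fun r _ => ?_
    rw [← hnotOdd, sum_filter_add_sum_filter_not]
  -- positivity of the masses and the arithmetic input `log 2 · H > πO`
  have hPO0 : 0 < PO := by
    have h1 : (1 : ℕ) ∈ O := by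
      rw [hO, mem_filter, mem_Icc]; exact ⟨⟨le_rfl, by omega⟩, odd_one⟩
    have := single_le_sum (f := fun r : ℕ => (1 : ℝ) / r) (fun r _ => by positivity) h1
    simp only [Nat.cast_one, div_one] at this
    rw [hPO]; linarith
  have hPE0 : 0 < PE := by
    have h2 : (2 : ℕ) ∈ Ev := by
      rw [hEv, mem_filter, mem_Icc]; exact ⟨⟨by norm_num, by omega⟩, even_two⟩
    have := single_le_sum (f := fun r : ℕ => (1 : ℝ) / r) (fun r _ => by positivity) h2
    rw [hPE]
    exact lt_of_lt_of_le (by norm_num) this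
  have hL : PO < Real.log 2 * (PO + PE) := sum_odd_inv_lt_log_two_mul hM
  -- the even block: `hE` is `SE − |aE|²/πE ≤ DE`
  have hE' : SE - ‖aE‖ ^ 2 / PE ≤ DE := by
    have eSE : SE = ∑ j ∈ Icc 1 (M / 2), ‖y (2 * j)‖ ^ 2 := by
      rw [hSE, hEv, sum_filter_even_eq_sum_half]
    have eaE : aE = ((Real.sqrt 2 : ℝ) : ℂ)⁻¹ *
        ∑ j ∈ Icc 1 (M / 2), y (2 * j) * ((Real.sqrt (j : ℝ) : ℝ) : ℂ)⁻¹ := by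
      rw [haE, hEv, sum_filter_even_eq_sum_half, mul_sum]
      refine sum_congr rfl fun j _ => ?_
      simp only [hu]
      have : ((Real.sqrt ((2 * j : ℕ) : ℝ) : ℝ) : ℂ) = ((Real.sqrt 2 : ℝ) : ℂ) * ((Real.sqrt (j : ℝ) : ℝ) : ℂ) := by
        push_cast
        rw [Real.sqrt_mul (by norm_num : (0:ℝ) ≤ 2)]
        push_cast; ring
      rw [this, mul_inv]
      ring
    have ePE : PE = (1 / 2) * ∑ j ∈ Icc 1 (M / 2), (1 : ℝ) / j := by
      rw [hPE, hEv, sum_filter_even_eq_sum_half, mul_sum]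
      refine sum_congr rfl fun j _ => ?_
      push_cast
      ring
    have eDE : DE = ∑ m ∈ Icc 1 (M / 2), ∑ n ∈ Icc 1 (M / 2 / m), (ArithmeticFunction.vonMangoldt n : ℝ) *
        ‖y (2 * (n * m)) - ((Real.sqrt n : ℂ))⁻¹ * y (2 * m)‖ ^ 2 := by
      rw [hDE, hEv, sum_filter_even_eq_sum_half]
      refine sum_congr rfl fun j _ => ?_
      rw [Nat.div_div_eq_div_mul]
      refine sum_congr rfl fun n _ => ?_
      simp only [hF, mul_left_comm n 2 j]
    have hs2 : ‖((Real.sqrt 2 : ℝ) : ℂ)⁻¹‖ ^ 2 = 1 / 2 := by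
      rw [norm_inv, Complex.norm_real, Real.norm_eq_abs, abs_of_nonneg (Real.sqrt_nonneg _),
        inv_pow, Real.sq_sqrt (by norm_num : (0:ℝ) ≤ 2), one_div]
    have hH2 : 0 ≤ ∑ j ∈ Icc 1 (M / 2), (1 : ℝ) / j := sum_nonneg fun j _ => by positivity
    rw [eSE, eDE, eaE, ePE, norm_mul, mul_pow, hs2]
    have : 1 / 2 * ‖∑ j ∈ Icc 1 (M / 2), y (2 * j) * ((Real.sqrt (j : ℝ) : ℝ) : ℂ)⁻¹‖ ^ 2 /
        (1 / 2 * ∑ j ∈ Icc 1 (M / 2), (1 : ℝ) / j) =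
        ‖∑ j ∈ Icc 1 (M / 2), y (2 * j) * ((Real.sqrt (j : ℝ) : ℝ) : ℂ)⁻¹‖ ^ 2 /
        (∑ j ∈ Icc 1 (M / 2), (1 : ℝ) / j) := by
      rw [mul_div_mul_left _ _ (by norm_num : (1:ℝ) / 2 ≠ 0)]
    rw [this]
    exact hE
  -- the cross edges `r → 2^a r`: `CR ≥ log 2 · C2`
  have hCR : Real.log 2 * C2 ≤ CR := by
    rw [hC2, hCR, mul_sum]
    refine sum_le_sum fun r hr => ?_
    rw [hO, mem_filter, mem_Icc] at hr
    obtain ⟨⟨hr1, hrM⟩, -⟩ := hr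
    have hMr : M / r ≠ 0 := (Nat.div_pos hrM hr1).ne'
    have himg : (Icc 1 (Nat.log 2 (M / r))).image (fun a => 2 ^ a) ⊆
        (Icc 1 (M / r)).filter (fun n => Even n) := by
      intro n hn
      simp only [mem_image, mem_Icc] at hn
      obtain ⟨a, ⟨ha1, haA⟩, rfl⟩ := hn
      simp only [mem_filter, mem_Icc]
      refine ⟨⟨Nat.one_le_two_pow, ?_⟩, ?_⟩
      · exact (Nat.pow_le_pow_right (by norm_num) haA).trans (Nat.pow_log_le_self 2 hMr)
      · obtain ⟨b, rfl⟩ : ∃ b, a = b + 1 := ⟨a - 1, by omega⟩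
        exact ⟨2 ^ b, by ring⟩
    have hinj : Set.InjOn (fun a : ℕ => 2 ^ a) (Icc 1 (Nat.log 2 (M / r)) : Set ℕ) :=
      fun a _ b _ h => Nat.pow_right_injective le_rfl h
    calc Real.log 2 * ∑ a ∈ Icc 1 (Nat.log 2 (M / r)),
          ‖y (2 ^ a * r) - ((Real.sqrt ((2 ^ a : ℕ) : ℝ) : ℝ) : ℂ)⁻¹ * y r‖ ^ 2
        = ∑ n ∈ (Icc 1 (Nat.log 2 (M / r))).image (fun a => 2 ^ a), F r n := by
          rw [sum_image hinj, mul_sum]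
          refine sum_congr rfl fun a ha => ?_
          have ha1 : 1 ≤ a := (mem_Icc.1 ha).1
          simp only [hF]
          rw [ArithmeticFunction.vonMangoldt_apply_pow (by omega : a ≠ 0),
            ArithmeticFunction.vonMangoldt_apply_prime Nat.prime_two]
          push_cast
          ring
      _ ≤ ∑ n ∈ (Icc 1 (M / r)).filter (fun n => Even n), F r n :=
          sum_le_sum_of_subset_of_nonneg himg fun n _ _ => by simp only [hF]; positivity
  -- Cauchy–Schwarz on the cross edges: `|aE − T|² ≤ πE · C2`
  have hCS : ‖aE - T‖ ^ 2 ≤ PE * C2 := by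
    -- the three sigma-sums
    set S := O.sigma (fun r => Icc 1 (Nat.log 2 (M / r))) with hSdef
    set w : (Σ _ : ℕ, ℕ) → ℝ := fun x => (Real.sqrt ((2 ^ x.2 * x.1 : ℕ) : ℝ))⁻¹ with hw
    set z : (Σ _ : ℕ, ℕ) → ℂ := fun x =>
      y (2 ^ x.2 * x.1) - ((Real.sqrt ((2 ^ x.2 : ℕ) : ℝ) : ℝ) : ℂ)⁻¹ * y x.1 with hz
    have hw0 : ∀ x, 0 ≤ w x := fun x => by simp only [hw]; positivity
    -- `Σ w z = aE − T`
    have e1 : ∑ x ∈ S, ((w x : ℝ) : ℂ) * z x = aE - T := by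
      have split : ∀ x ∈ S, ((w x : ℝ) : ℂ) * z x =
          y (2 ^ x.2 * x.1) * u (2 ^ x.2 * x.1) -
            y x.1 * u x.1 * ((2 : ℂ) ^ x.2)⁻¹ := by
        rintro ⟨r, a⟩ hx
        simp only [hw, hz, hu, Complex.ofReal_inv]
        have hr0 : (0 : ℝ) ≤ r := Nat.cast_nonneg r
        have h2 : ((Real.sqrt ((2 ^ a * r : ℕ) : ℝ) : ℝ) : ℂ) =
            ((Real.sqrt ((2 ^ a : ℕ) : ℝ) : ℝ) : ℂ) * ((Real.sqrt (r : ℝ) : ℝ) : ℂ) := by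
          rw [Nat.cast_mul, Real.sqrt_mul (by positivity)]
          push_cast; ring
        have h3 : ((Real.sqrt ((2 ^ a : ℕ) : ℝ) : ℝ) : ℂ)⁻¹ * ((Real.sqrt ((2 ^ a : ℕ) : ℝ) : ℝ) : ℂ)⁻¹ =
            ((2 : ℂ) ^ a)⁻¹ := by
          rw [← mul_inv, ← Complex.ofReal_mul, Real.mul_self_sqrt (by positivity)]
          push_cast; ring
        rw [h2, ← h3]
        ring
      rw [sum_congr rfl split, sum_sub_distrib]
      congr 1
      · rw [haE, hSdef, ← sum_sigma' O (fun r => Icc 1 (Nat.log 2 (M / r)))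
          (fun r a => y (2 ^ a * r) * u (2 ^ a * r))]
        exact sum_odd_sum_twoPow_eq_sum_even M (fun k => y k * u k)
      · rw [hT, hSdef, ← sum_sigma' O (fun r => Icc 1 (Nat.log 2 (M / r)))
          (fun r a => y r * u r * ((2 : ℂ) ^ a)⁻¹)]
        refine sum_congr rfl fun r _ => ?_
        rw [← mul_sum, sum_Icc_inv_two_pow]
    -- `Σ w² = πE`
    have e2 : ∑ x ∈ S, w x ^ 2 = PE := by
      have : ∀ x ∈ S, w x ^ 2 = (1 : ℝ) / ((2 ^ x.2 * x.1 : ℕ) : ℝ) := by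
        rintro ⟨r, a⟩ -
        simp only [hw]
        rw [inv_pow, Real.sq_sqrt (by positivity), one_div]
      rw [sum_congr rfl this, hPE, hSdef,
        ← sum_sigma' O (fun r => Icc 1 (Nat.log 2 (M / r))) (fun r a => (1 : ℝ) / ((2 ^ a * r : ℕ) : ℝ))]
      exact sum_odd_sum_twoPow_eq_sum_even M (fun k => (1 : ℝ) / (k : ℝ))
    -- `Σ ‖z‖² = C2`
    have e3 : ∑ x ∈ S, ‖z x‖ ^ 2 = C2 := by
      rw [hC2, hSdef, ← sum_sigma' O (fun r => Icc 1 (Nat.log 2 (M / r)))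
        (fun r a => ‖y (2 ^ a * r) - ((Real.sqrt ((2 ^ a : ℕ) : ℝ) : ℝ) : ℂ)⁻¹ * y r‖ ^ 2)]
    -- Cauchy–Schwarz
    have h1 : ‖aE - T‖ ≤ ∑ x ∈ S, w x * ‖z x‖ := by
      rw [← e1]
      refine (norm_sum_le _ _).trans (le_of_eq (sum_congr rfl fun x _ => ?_))
      rw [norm_mul, Complex.norm_real, Real.norm_eq_abs, abs_of_nonneg (hw0 x)]
    have h2 : (∑ x ∈ S, w x * ‖z x‖) ^ 2 ≤ (∑ x ∈ S, w x ^ 2) * ∑ x ∈ S, ‖z x‖ ^ 2 :=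
      sum_mul_sq_le_sq_mul_sq S w (fun x => ‖z x‖)
    rw [e2, e3] at h2
    calc ‖aE - T‖ ^ 2 ≤ (∑ x ∈ S, w x * ‖z x‖) ^ 2 := by
          exact pow_le_pow_left₀ (norm_nonneg _) h1 2
      _ ≤ PE * C2 := h2
  -- the scalar two-block inequality
  have hTB := twoBlock_complex hPO0 hPE0 hL aO aE T
  -- assemble
  have hR' : SO - ‖aO‖ ^ 2 / PO +
      Real.log 2 * PO * PE / (Real.log 2 * (PO + PE) - PO) * ‖T / PE - aO / PO‖ ^ 2 ≤ DO := by
    have := hR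
    rw [hH] at this
    exact this
  have hlast : Real.log 2 / PE * ‖aE - T‖ ^ 2 ≤ CR := by
    calc Real.log 2 / PE * ‖aE - T‖ ^ 2 ≤ Real.log 2 / PE * (PE * C2) := by
          refine mul_le_mul_of_nonneg_left hCS ?_
          exact div_nonneg (Real.log_nonneg (by norm_num)) hPE0.le
      _ = Real.log 2 * C2 := by field_simp
      _ ≤ CR := hCR
  rw [hH, hS, hA]
  change SO + SE - ‖aO + aE‖ ^ 2 / (PO + PE) ≤ ∑ m ∈ Icc 1 M, ∑ n ∈ Icc 1 (M / m), F m n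
  rw [hD]
  linarith [hTB, hR', hE', hlast]

/-- **The induction, assembled.**  Fix `N ≥ 12`.  If the variance inequality `V(M)` is known directly
for `12 ≤ M < 2N` (finitely many quadratic forms; numerically `λ₂(D_M) ≥ 1.052` there, while
`λ₂(D_7) = 0.986` and `λ₂(D_9) = 0.997 < 1` forbid starting lower with the plain step) and the
odd-block inequality `R(M)` (hypothesis `hR` of `divisorGap_parityStep`) holds for every `M ≥ 2N`, then
the registered stub `stub_divisorGapPerp` holds for every `M ≥ 12` (strong induction on `M` through
`M ↦ ⌊M/2⌋`, `divisorGap_parityStep`, `divisorGap_of_variance`). -/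
theorem divisorGap_of_base_of_oddBlock (N : ℕ) (hN : 12 ≤ N)
    (hbase : ∀ (M : ℕ) (y : ℕ → ℂ), 12 ≤ M → M < 2 * N →
      ∑ m ∈ Icc 1 M, ‖y m‖ ^ 2 -
          ‖∑ m ∈ Icc 1 M, y m * ((Real.sqrt (m : ℝ) : ℝ) : ℂ)⁻¹‖ ^ 2 / (∑ m ∈ Icc 1 M, (1 : ℝ) / m) ≤
        ∑ m ∈ Icc 1 M, ∑ n ∈ Icc 1 (M / m), (ArithmeticFunction.vonMangoldt n : ℝ) *
          ‖y (n * m) - ((Real.sqrt n : ℂ))⁻¹ * y m‖ ^ 2)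
    (hR : ∀ (M : ℕ) (y : ℕ → ℂ), 2 * N ≤ M →
      ∑ r ∈ (Icc 1 M).filter (fun r => Odd r), ‖y r‖ ^ 2 -
        ‖∑ r ∈ (Icc 1 M).filter (fun r => Odd r), y r * ((Real.sqrt (r : ℝ) : ℝ) : ℂ)⁻¹‖ ^ 2 /
          (∑ r ∈ (Icc 1 M).filter (fun r => Odd r), (1 : ℝ) / r) +
        Real.log 2 * (∑ r ∈ (Icc 1 M).filter (fun r => Odd r), (1 : ℝ) / r) *
            (∑ k ∈ (Icc 1 M).filter (fun k => Even k), (1 : ℝ) / k) /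
          (Real.log 2 * (∑ m ∈ Icc 1 M, (1 : ℝ) / m) -
            ∑ r ∈ (Icc 1 M).filter (fun r => Odd r), (1 : ℝ) / r) *
        ‖(∑ r ∈ (Icc 1 M).filter (fun r => Odd r),
              y r * ((Real.sqrt (r : ℝ) : ℝ) : ℂ)⁻¹ * (1 - ((2 : ℂ) ^ Nat.log 2 (M / r))⁻¹)) /
            ((∑ k ∈ (Icc 1 M).filter (fun k => Even k), (1 : ℝ) / k : ℝ) : ℂ) -
          (∑ r ∈ (Icc 1 M).filter (fun r => Odd r), y r * ((Real.sqrt (r : ℝ) : ℝ) : ℂ)⁻¹) /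
            ((∑ r ∈ (Icc 1 M).filter (fun r => Odd r), (1 : ℝ) / r : ℝ) : ℂ)‖ ^ 2 ≤
      ∑ r ∈ (Icc 1 M).filter (fun r => Odd r), ∑ n ∈ (Icc 1 (M / r)).filter (fun n => Odd n),
        (ArithmeticFunction.vonMangoldt n : ℝ) * ‖y (n * r) - ((Real.sqrt n : ℂ))⁻¹ * y r‖ ^ 2) :
    ∀ (M : ℕ) (y : ℕ → ℂ), 12 ≤ M →
      ∑ m ∈ Icc 1 M, y m * ((Real.sqrt (m : ℝ) : ℝ) : ℂ)⁻¹ = 0 →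
      ∑ m ∈ Icc 1 M, ‖y m‖ ^ 2 ≤
        ∑ m ∈ Icc 1 M, ∑ n ∈ Icc 1 (M / m), (ArithmeticFunction.vonMangoldt n : ℝ) *
          ‖y (n * m) - ((Real.sqrt n : ℂ))⁻¹ * y m‖ ^ 2 := by
  -- the variance inequality `V(M)` for all `M ≥ 12`, by strong induction
  have hV : ∀ (M : ℕ), 12 ≤ M → ∀ (y : ℕ → ℂ),
      ∑ m ∈ Icc 1 M, ‖y m‖ ^ 2 -
          ‖∑ m ∈ Icc 1 M, y m * ((Real.sqrt (m : ℝ) : ℝ) : ℂ)⁻¹‖ ^ 2 / (∑ m ∈ Icc 1 M, (1 : ℝ) / m) ≤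
        ∑ m ∈ Icc 1 M, ∑ n ∈ Icc 1 (M / m), (ArithmeticFunction.vonMangoldt n : ℝ) *
          ‖y (n * m) - ((Real.sqrt n : ℂ))⁻¹ * y m‖ ^ 2 := by
    intro M
    induction M using Nat.strong_induction_on with
    | _ M ih =>
      intro hM y
      by_cases hlt : M < 2 * N
      · exact hbase M y hM hlt
      · push Not at hlt
        have h2 : 12 ≤ M / 2 := by omega
        have hlt2 : M / 2 < M := by omega
        exact divisorGap_parityStep M (by omega) y (ih (M / 2) hlt2 h2 (fun j => y (2 * j)))
          (hR M y hlt)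
  intro M y hM hy
  exact divisorGap_of_variance M y (hV M hM y) hy


/-- **Registered form (`stub_divisorGapParityReduction`, uncurried) of `divisorGap_of_base_of_oddBlock`**:
the divisor-graph gap `‖y‖² ≤ D(y)` on the Perron complement for all `M ≥ 12` follows from finitely many
base cases `12 ≤ M < 2N` (variance form) and the odd-block inequality `R(M)` for `M ≥ 2N`. -/
theorem stub_divisorGapParityReduction : ∀ (N : ℕ), 12 ≤ N → (∀ (M : ℕ) (y : ℕ → ℂ), 12 ≤ M → M < 2 * N → ∑ m ∈ Icc 1 M, ‖y m‖ ^ 2 - ‖∑ m ∈ Icc 1 M, y m * ((Real.sqrt (m : ℝ) : ℝ) : ℂ)⁻¹‖ ^ 2 / (∑ m ∈ Icc 1 M, (1 : ℝ) / m) ≤ ∑ m ∈ Icc 1 M, ∑ n ∈ Icc 1 (M / m), (ArithmeticFunction.vonMangoldt n : ℝ) * ‖y (n * m) - ((Real.sqrt n : ℂ))⁻¹ * y m‖ ^ 2) → (∀ (M : ℕ) (y : ℕ → ℂ), 2 * N ≤ M → ∑ r ∈ (Icc 1 M).filter (fun r => Odd r), ‖y r‖ ^ 2 - ‖∑ r ∈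 (Icc 1 M).filter (fun r => Odd r), y r * ((Real.sqrt (r : ℝ) : ℝ) : ℂ)⁻¹‖ ^ 2 / (∑ r ∈ (Icc 1 M).filter (fun r => Odd r), (1 : ℝ) / r) + Real.log 2 * (∑ r ∈ (Icc 1 M).filter (fun r => Odd r), (1 : ℝ) / r) * (∑ k ∈ (Icc 1 M).filter (fun k => Even k), (1 : ℝ) / k) / (Real.log 2 * (∑ m ∈ Icc 1 M, (1 : ℝ) / m) - ∑ r ∈ (Icc 1 M).filter (fun r => Odd r), (1 : ℝ) / r) * ‖(∑ r ∈ (Icc 1 M).filter (fun r => Odd r), y r * ((Real.sqrt (r : ℝ) : ℝ) : ℂ)⁻¹ * (1 - ((2 : ℂ) ^ Nat.log 2 (M / r))⁻¹)) / ((∑ k ∈ (Icc 1 M).filter (fun k => Even k), (1 : ℝ) / k : ℝ) : ℂ) - (∑ r ∈ (Icc 1 M).filter (fun r => Odd r), y r * ((Real.sqrt (r : ℝ) : ℝ) : ℂ)⁻¹) / ((∑ r ∈ (Icc 1 M).filter (fun r => Odd r), (1 : ℝ) / r : ℝ) : ℂ)‖ ^ 2 ≤ ∑ r ∈ (Icc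 1 M).filter (fun r => Odd r), ∑ n ∈ (Icc 1 (M / r)).filter (fun n => Odd n), (ArithmeticFunction.vonMangoldt n : ℝ) * ‖y (n * r) - ((Real.sqrt n : ℂ))⁻¹ * y r‖ ^ 2) → ∀ (M : ℕ) (y : ℕ → ℂ), 12 ≤ M → ∑ m ∈ Icc 1 M, y m * ((Real.sqrt (m : ℝ) : ℝ) : ℂ)⁻¹ = 0 → ∑ m ∈ Icc 1 M, ‖y m‖ ^ 2 ≤ ∑ m ∈ Icc 1 M, ∑ n ∈ Icc 1 (M / m), (ArithmeticFunction.vonMangoldt n : ℝ) * ‖y (n * m) - ((Real.sqrt n : ℂ))⁻¹ * y m‖ ^ 2 :=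
  fun N hN hbase hR => divisorGap_of_base_of_oddBlock N hN hbase hR

end Summit.RiemannHypothesis.RiemannHypothesis.Theorems.WeilCombBohrFejer

end
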